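import Mathlib.Analysis.InnerProductSpace.Calculus
import Mathlib.Analysis.Calculus.ContDiff.Basic
import Mathlib.Analysis.SpecialFunctions.SmoothTransition
import Mathlib.Analysis.Calculus.Deriv.Prod
import Mathlib.Analysis.Calculus.Deriv.Comp
import Mathlib.Analysis.InnerProductSpace.EuclideanDist
import Mathlib.Topology.MetricSpace.ProperSpace
import Literature.Topology.FourManifolds.SlabFlow
import Mathlib.Geometry.Euclidean.Inversion.Calculus
import HarnessLib

/-!
# Thick alignment of ball parametrisations along a boundary cap

Topic `Literature/Topology/FourManifolds`.  In the gluing step of the Morse-theoretic proof of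
the smooth Schönflies theorem (Schultens, *Introduction to 3-Manifolds* (2014), Thm. 3.2.5 with
Lemma 3.2.3: a ball attached to a ball along a disc) one needs a parametrisation of the sub-ball
`B` by the unit ball which is *explicit* on a solid sector below a boundary cap — not merely on a
thin collar of the cap (which is what uniqueness of collars gives, `CapGermAlignment.lean`).
This file proves the necessary **thick alignment lemma**: an embedding `j` of a neighbourhood of
a solid cap sector of the closed unit ball into the ball, which is the identity on a two-sided
shell along the cap and maps interior points to interior points, agrees on a (smaller, but
thick) solid sector with a diffeomorphism `χ` of the whole space preserving the unit ball and
fixing the unit sphere pointwise.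

The proof is the classical "dilation" argument made global by a conformal chart: the inversion
`ψ` in the sphere of radius `√2` about the south pole `-u` exchanges the unit sphere with the
hyperplane `u^⊥` and the unit ball with a half-space (§1); conjugating the dilations `y ↦ t y`
by `ψ` gives a one-parameter group `D_t` of conformal maps of the ball fixing the north pole `u`
(§2); `j_t = D_t⁻¹ ∘ j ∘ D_t` is an isotopy from the identity (small `t`: everything is dilated
into the shell where `j = id`) to `j` (`t = 1`), stationary near the cap (§3); its velocity
field, cut off and extended by zero, is a smooth compactly supported time-dependent vector field
vanishing on the sphere (§4), whose flow at time `1` is the required `χ` (§5,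
`SlabFlow.lean`).

## References
* J. Schultens, *Introduction to 3-Manifolds*, GSM 151, AMS (2014), Lemma 3.2.3, Thm. 3.2.5.
* M. W. Hirsch, *Differential Topology*, GTM 33 (1976), Ch. 8 §1 (isotopy extension), §3.
* R. Palais, *Extending diffeomorphisms*, Proc. AMS 11 (1960) 274–277.
-/

noncomputable section

open Set Metric Filter Topology
open scoped ContDiff RealInnerProductSpace Manifold

namespace Literature.Topology.FourManifolds.ThickAlignment

variable {E : Type*} [NormedAddCommGroup E] [InnerProductSpace ℝ E]

/-! ### §1 The inversion exchanging the unit sphere and a hyperplane -/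

/-- **The inversion** in the sphere of radius `√2` about the south pole `-u` — Mathlib's
`EuclideanGeometry.inversion (-u) √2`: `ψ(x) = -u + 2 (x + u)/‖x + u‖²`. [folklore] -/
def inv (u x : E) : E := EuclideanGeometry.inversion (-u) (Real.sqrt 2) x

/-- **The closed form** `ψ(x) = -u + (2/‖x + u‖²)(x + u)`. [folklore] -/
theorem inv_eq (u x : E) : inv u x = -u + (2 / ‖x + u‖ ^ 2) • (x + u) := by
  rw [inv, EuclideanGeometry.inversion]
  simp only [vsub_eq_sub, vadd_eq_add, sub_neg_eq_add, dist_eq_norm]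
  rw [div_pow, Real.sq_sqrt (by norm_num : (0 : ℝ) ≤ 2)]
  abel

variable {u : E}

omit [InnerProductSpace ℝ E] in
/-- `x ≠ -u ↔ x + u ≠ 0`. [folklore] -/
theorem add_ne_zero_iff [NormedSpace ℝ E] {x : E} : x + u ≠ 0 ↔ x ≠ -u := by
  rw [Ne, add_eq_zero_iff_eq_neg]

/-- `ψ(x) + u = (2/‖x+u‖²)(x + u)`. [folklore] -/
theorem inv_add (u x : E) : inv u x + u = (2 / ‖x + u‖ ^ 2) • (x + u) := by
  rw [inv_eq]; abel

/-- `‖ψ(x) + u‖ = 2/‖x + u‖` (Mathlib's `EuclideanGeometry.dist_inversion_center`; at the pole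
both sides vanish). [folklore] -/
theorem norm_inv_add (x : E) : ‖inv u x + u‖ = 2 / ‖x + u‖ := by
  have h := EuclideanGeometry.dist_inversion_center (-u) x (Real.sqrt 2)
  rw [Real.sq_sqrt (by norm_num : (0 : ℝ) ≤ 2), dist_eq_norm, dist_eq_norm, sub_neg_eq_add,
    sub_neg_eq_add] at h
  exact h

/-- `ψ(x) ≠ -u` (`x ≠ -u`). [folklore] -/
theorem inv_ne {x : E} (hx : x ≠ -u) : inv u x ≠ -u := by
  intro h
  have := norm_inv_add (u := u) x
  rw [h, neg_add_cancel, norm_zero] at this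
  have h0 : 0 < ‖x + u‖ := norm_pos_iff.2 (add_ne_zero_iff.2 hx)
  have : (0 : ℝ) < 2 / ‖x + u‖ := by positivity
  linarith

/-- **`ψ` is an involution** (Mathlib's `EuclideanGeometry.inversion_inversion`). [folklore] -/
theorem inv_inv (x : E) : inv u (inv u x) = x :=
  EuclideanGeometry.inversion_inversion (-u) (Real.sqrt_pos.2 two_pos).ne' x

/-- `ψ(u) = 0`. [folklore] -/
theorem inv_self (hu : ‖(u : E)‖ = 1) : inv u u = 0 := by
  have h2 : u + u = (2 : ℝ) • u := by rw [two_smul]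
  rw [inv_eq, h2, norm_smul, Real.norm_eq_abs, abs_of_pos two_pos, hu, mul_one, smul_smul]
  norm_num

/-- `ψ(0) = u`. [folklore] -/
theorem inv_zero (hu : ‖(u : E)‖ = 1) : inv u 0 = u := by
  rw [inv_eq, zero_add, hu]; norm_num; rw [two_smul]; abel

/-- **The height of `ψ(x)`**: `⟪ψ(x), u⟫ = (1 - ‖x‖²)/‖x + u‖²` — so `ψ` maps the unit sphere to
the hyperplane `u^⊥`, the open unit ball to the half-space `{⟪·, u⟫ > 0}` and the exterior to
`{⟪·, u⟫ < 0}`. [folklore] -/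
theorem inner_inv (hu : ‖(u : E)‖ = 1) {x : E} (hx : x ≠ -u) :
    ⟪inv u x, u⟫ = (1 - ‖x‖ ^ 2) / ‖x + u‖ ^ 2 := by
  have h0 : ‖x + u‖ ≠ 0 := norm_ne_zero_iff.2 (add_ne_zero_iff.2 hx)
  have hxu : ‖x + u‖ ^ 2 = ‖x‖ ^ 2 + 2 * ⟪x, u⟫ + 1 := by
    rw [norm_add_sq_real, hu]; ring
  have huu : ⟪u, u⟫ = 1 := by rw [real_inner_self_eq_norm_sq, hu]; norm_num
  rw [inv_eq, inner_add_left, inner_neg_left, inner_smul_left, inner_add_left, huu]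
  simp only [conj_trivial]
  field_simp
  rw [hxu]; ring

/-- **The norm of `ψ(x)`**: `‖ψ(x)‖² = 1 - 4⟪x, u⟫/‖x + u‖²`. [folklore] -/
theorem norm_inv_sq (hu : ‖(u : E)‖ = 1) {x : E} (hx : x ≠ -u) :
    ‖inv u x‖ ^ 2 = 1 - 4 * ⟪x, u⟫ / ‖x + u‖ ^ 2 := by
  have h0 : ‖x + u‖ ≠ 0 := norm_ne_zero_iff.2 (add_ne_zero_iff.2 hx)
  have hxu : ‖x + u‖ ^ 2 = ‖x‖ ^ 2 + 2 * ⟪x, u⟫ + 1 := by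
    rw [norm_add_sq_real, hu]; ring
  have : inv u x = (2 / ‖x + u‖ ^ 2) • (x + u) - u := by rw [inv_eq]; abel
  rw [this, norm_sub_sq_real, norm_smul, inner_smul_left, Real.norm_eq_abs,
    abs_of_pos (by positivity), inner_add_left, real_inner_self_eq_norm_sq, hu]
  simp only [conj_trivial, real_inner_comm u x]
  field_simp
  rw [hxu]; ring

/-- `ψ` is smooth off the pole `-u` (Mathlib's `ContDiffOn.inversion`). [folklore] -/
theorem contDiffOn_inv (u : E) : ContDiffOn ℝ ∞ (inv u) {x | x ≠ -u} := by
  show ContDiffOn ℝ ∞ (fun x : E => EuclideanGeometry.inversion (-u) (Real.sqrt 2) x) {x | x ≠ -u}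
  exact contDiffOn_const.inversion contDiffOn_const contDiffOn_id fun x hx => hx

/-- `ψ` is smooth in a neighbourhood of every `x ≠ -u`. [folklore] -/
theorem contDiffAt_inv {x : E} (hx : x ≠ -u) : ContDiffAt ℝ ∞ (inv u) x :=
  (contDiffOn_inv u).contDiffAt ((isOpen_ne.mem_nhds hx))

/-- **Points with `‖ψ x‖ ≤ r < 1` lie in the cone** `⟪x, u⟫ ≥ ((1-r²)/(1+r²)) ‖x‖` and have
`⟪x, u⟫ > 0`. [folklore] -/
theorem inner_ge_of_norm_inv_le (hu : ‖(u : E)‖ = 1) {x : E} (hx : x ≠ -u) {r : ℝ}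
    (h : ‖inv u x‖ ≤ r) :
    (1 - r ^ 2) * (‖x‖ ^ 2 + 1) ≤ 2 * (1 + r ^ 2) * ⟪x, u⟫ := by
  have h0 : 0 < ‖x + u‖ ^ 2 := by
    have := norm_pos_iff.2 (add_ne_zero_iff.2 hx); positivity
  have hxu : ‖x + u‖ ^ 2 = ‖x‖ ^ 2 + 2 * ⟪x, u⟫ + 1 := by
    rw [norm_add_sq_real, hu]; ring
  have hsq : ‖inv u x‖ ^ 2 ≤ r ^ 2 := by
    have := norm_nonneg (inv u x)
    nlinarith
  rw [norm_inv_sq hu hx] at hsq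
  -- `1 - 4⟪x,u⟫/‖x+u‖² ≤ r²`
  have h1 : (1 - r ^ 2) * ‖x + u‖ ^ 2 ≤ 4 * ⟪x, u⟫ := by
    have := mul_le_mul_of_nonneg_right hsq h0.le
    rw [sub_mul, div_mul_cancel₀ _ h0.ne', one_mul] at this
    linarith
  rw [hxu] at h1
  nlinarith

/-- The direction cosine on the lens `‖ψ x‖ ≤ r` (`0 ≤ r < 1`):
`⟪x, u⟫ ≥ ((1-r²)/(1+r²)) ‖x‖`. [folklore] -/
theorem inner_ge_mul_norm_of_norm_inv_le (hu : ‖(u : E)‖ = 1) {x : E} (hx : x ≠ -u) {r : ℝ}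
    (hr0 : 0 ≤ r) (hr1 : r < 1) (h : ‖inv u x‖ ≤ r) :
    (1 - r ^ 2) / (1 + r ^ 2) * ‖x‖ ≤ ⟪x, u⟫ := by
  have h1 := inner_ge_of_norm_inv_le hu hx h
  have hpos : 0 < 1 + r ^ 2 := by positivity
  have hr : 0 ≤ 1 - r ^ 2 := by nlinarith
  rw [div_mul_eq_mul_div, div_le_iff₀ hpos]
  have h2 : 2 * ‖x‖ ≤ ‖x‖ ^ 2 + 1 := by nlinarith [sq_nonneg (‖x‖ - 1)]
  nlinarith [mul_le_mul_of_nonneg_left h2 hr]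

/-- **The target sector lies in the lens**: if `‖x‖ ≤ 1` and `⟪x, u⟫ ≥ m` with
`(1 - m)/(1 + m) ≤ r²` (`0 < m`), then `‖ψ x‖ ≤ r`. [folklore] -/
theorem norm_inv_le_of_inner_ge (hu : ‖(u : E)‖ = 1) {x : E} (hx1 : ‖x‖ ≤ 1) {m r : ℝ}
    (hm : 0 < m) (hr : 0 ≤ r) (hmr : (1 - m) / (1 + m) ≤ r ^ 2) (hxm : m ≤ ⟪x, u⟫) :
    ‖inv u x‖ ≤ r := by
  have hx : x ≠ -u := by
    intro h
    rw [h, inner_neg_left, real_inner_self_eq_norm_sq, hu] at hxm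
    linarith
  have h0 : 0 < ‖x + u‖ ^ 2 := by
    have := norm_pos_iff.2 (add_ne_zero_iff.2 hx); positivity
  have hxu : ‖x + u‖ ^ 2 = ‖x‖ ^ 2 + 2 * ⟪x, u⟫ + 1 := by
    rw [norm_add_sq_real, hu]; ring
  have hle : ‖x + u‖ ^ 2 ≤ 2 + 2 * ⟪x, u⟫ := by
    rw [hxu]; nlinarith [norm_nonneg x]
  have hsq : ‖inv u x‖ ^ 2 ≤ r ^ 2 := by
    rw [norm_inv_sq hu hx]
    -- `1 - 4⟪x,u⟫/‖x+u‖² ≤ 1 - 2m/(1+m) = (1-m)/(1+m)`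
    have h1 : 2 * m / (1 + m) ≤ 4 * ⟪x, u⟫ / ‖x + u‖ ^ 2 := by
      rw [div_le_div_iff₀ (by linarith) h0]
      nlinarith
    have h2 : (1 - m) / (1 + m) = 1 - 2 * m / (1 + m) := by field_simp; ring
    linarith
  nlinarith [norm_nonneg (inv u x), sq_nonneg (‖inv u x‖ - r), sq_nonneg (‖inv u x‖ + r)]

/-- **The lens is a round ball**: for `0 < r < 1`, `‖ψ x‖ ≤ r` iff `x` lies in the closed ball
about `α u` of radius `ρ`, `α = (1+r²)/(1-r²)`, `ρ = 2r/(1-r²)` (so `ρ² = α² - 1`). [folklore] -/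
theorem norm_inv_le_iff (hu : ‖(u : E)‖ = 1) {x : E} (hx : x ≠ -u) {r : ℝ} (hr0 : 0 < r)
    (hr1 : r < 1) :
    ‖inv u x‖ ≤ r ↔ ‖x - ((1 + r ^ 2) / (1 - r ^ 2)) • u‖ ≤ 2 * r / (1 - r ^ 2) := by
  have h0 : 0 < ‖x + u‖ ^ 2 := by
    have := norm_pos_iff.2 (add_ne_zero_iff.2 hx); positivity
  have hxu : ‖x + u‖ ^ 2 = ‖x‖ ^ 2 + 2 * ⟪x, u⟫ + 1 := by
    rw [norm_add_sq_real, hu]; ring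
  have hr2 : 0 < 1 - r ^ 2 := by nlinarith
  set α : ℝ := (1 + r ^ 2) / (1 - r ^ 2) with hα
  set ρ : ℝ := 2 * r / (1 - r ^ 2) with hρ
  have hρ0 : 0 < ρ := div_pos (by linarith) hr2
  have hαr : α * (1 - r ^ 2) = 1 + r ^ 2 := by rw [hα]; field_simp
  have hρr : ρ * (1 - r ^ 2) = 2 * r := by rw [hρ]; field_simp
  have hball : ‖x - α • u‖ ^ 2 = ‖x‖ ^ 2 - 2 * α * ⟪x, u⟫ + α ^ 2 := by
    rw [norm_sub_sq_real, norm_smul, inner_smul_right, Real.norm_eq_abs,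
      abs_of_pos (div_pos (by positivity) hr2), hu]; ring
  -- cleared forms
  have hA : ‖inv u x‖ ^ 2 ≤ r ^ 2 ↔ (1 - r ^ 2) * ‖x + u‖ ^ 2 ≤ 4 * ⟪x, u⟫ := by
    rw [norm_inv_sq hu hx]
    constructor
    · intro h
      have := mul_le_mul_of_nonneg_right h h0.le
      rw [sub_mul, div_mul_cancel₀ _ h0.ne', one_mul] at this
      linarith
    · intro h
      rw [sub_le_iff_le_add]
      have : 1 * ‖x + u‖ ^ 2 ≤ (r ^ 2 + 4 * ⟪x, u⟫ / ‖x + u‖ ^ 2) * ‖x + u‖ ^ 2 := by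
        rw [add_mul, div_mul_cancel₀ _ h0.ne']; linarith
      exact le_of_mul_le_mul_right this h0
  have hB : ‖x - α • u‖ ^ 2 ≤ ρ ^ 2 ↔ (1 - r ^ 2) * ‖x + u‖ ^ 2 ≤ 4 * ⟪x, u⟫ := by
    rw [hball, hxu]
    -- multiply through by `(1 - r²)²`
    have e1 : (‖x‖ ^ 2 - 2 * α * ⟪x, u⟫ + α ^ 2 - ρ ^ 2) * (1 - r ^ 2) ^ 2 =
        (1 - r ^ 2) * ((1 - r ^ 2) * (‖x‖ ^ 2 + 2 * ⟪x, u⟫ + 1) - 4 * ⟪x, u⟫) := by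
      have e2 : α ^ 2 * (1 - r ^ 2) ^ 2 = (1 + r ^ 2) ^ 2 := by
        calc α ^ 2 * (1 - r ^ 2) ^ 2 = (α * (1 - r ^ 2)) ^ 2 := by ring
          _ = (1 + r ^ 2) ^ 2 := by rw [hαr]
      have e3 : ρ ^ 2 * (1 - r ^ 2) ^ 2 = (2 * r) ^ 2 := by
        calc ρ ^ 2 * (1 - r ^ 2) ^ 2 = (ρ * (1 - r ^ 2)) ^ 2 := by ring
          _ = (2 * r) ^ 2 := by rw [hρr]
      have e4 : α * (1 - r ^ 2) ^ 2 = (1 + r ^ 2) * (1 - r ^ 2) := by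
        calc α * (1 - r ^ 2) ^ 2 = (α * (1 - r ^ 2)) * (1 - r ^ 2) := by ring
          _ = (1 + r ^ 2) * (1 - r ^ 2) := by rw [hαr]
      nlinarith [e2, e3, e4]
    have hsq : 0 < (1 - r ^ 2) ^ 2 := by positivity
    constructor
    · intro h
      have h' : (‖x‖ ^ 2 - 2 * α * ⟪x, u⟫ + α ^ 2 - ρ ^ 2) * (1 - r ^ 2) ^ 2 ≤ 0 :=
        mul_nonpos_of_nonpos_of_nonneg (by linarith) hsq.le
      rw [e1] at h'
      have := (mul_nonpos_iff.1 h')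
      rcases this with ⟨-, h2⟩ | ⟨h1, -⟩
      · linarith
      · linarith
    · intro h
      have h' : (‖x‖ ^ 2 - 2 * α * ⟪x, u⟫ + α ^ 2 - ρ ^ 2) * (1 - r ^ 2) ^ 2 ≤ 0 := by
        rw [e1]; exact mul_nonpos_of_nonneg_of_nonpos hr2.le (by linarith)
      have : ‖x‖ ^ 2 - 2 * α * ⟪x, u⟫ + α ^ 2 - ρ ^ 2 ≤ 0 := by
        by_contra hc; push Not at hc
        have := mul_pos hc hsq; linarith
      linarith
  -- pass between norms and their squares
  have hn1 := norm_nonneg (inv u x)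
  have hn2 := norm_nonneg (x - α • u)
  constructor
  · intro h
    have := (hB.2 (hA.1 (by nlinarith)))
    nlinarith
  · intro h
    have := (hA.2 (hB.1 (by nlinarith)))
    nlinarith

/-! ### §2 The conformal dilations fixing the pole -/

/-- **Conformal dilation** `D_t = ψ ∘ (t ·) ∘ ψ`: fixes `u`, preserves the unit sphere, the
ball and the exterior, and `D_s ∘ D_t = D_{st}`. [folklore] -/
def dil (u : E) (t : ℝ) (x : E) : E := inv u (t • inv u x)

/-- `⟪y, u⟫ ≠ -1 → y ≠ -u`. [folklore] -/
theorem ne_neg_of_inner_ne (hu : ‖(u : E)‖ = 1) {y : E} (h : ⟪y, u⟫ ≠ -1) : y ≠ -u := by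
  intro hy
  apply h
  rw [hy, inner_neg_left, real_inner_self_eq_norm_sq, hu]; norm_num

/-- For `x` in the closed unit ball (`x ≠ -u`) and `t ≥ 0`: `t ψ(x) ≠ -u`. [folklore] -/
theorem smul_inv_ne (hu : ‖(u : E)‖ = 1) {x : E} (hx : x ≠ -u) (hx1 : ‖x‖ ≤ 1) {t : ℝ}
    (ht : 0 ≤ t) : t • inv u x ≠ -u := by
  apply ne_neg_of_inner_ne hu
  rw [inner_smul_left, inner_inv hu hx]
  simp only [conj_trivial]
  have : 0 ≤ (1 - ‖x‖ ^ 2) / ‖x + u‖ ^ 2 := div_nonneg (by nlinarith [norm_nonneg x]) (sq_nonneg _)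
  nlinarith [mul_nonneg ht this]

/-- In the thin exterior shell `1 ≤ ‖x‖² ≤ 3/2` (`x ≠ -u`, `⟪x,u⟫ ≥ 0`), `t ψ(x) ≠ -u` for
`0 ≤ t ≤ 1`. [folklore] -/
theorem smul_inv_ne_of_shell (hu : ‖(u : E)‖ = 1) {x : E} (hx : x ≠ -u) (hx2 : ‖x‖ ^ 2 ≤ 3 / 2)
    (hxu : 0 ≤ ⟪x, u⟫) {t : ℝ} (ht : 0 ≤ t) (ht1 : t ≤ 1) : t • inv u x ≠ -u := by
  apply ne_neg_of_inner_ne hu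
  rw [inner_smul_left, inner_inv hu hx]
  simp only [conj_trivial]
  have h0 : 0 < ‖x + u‖ ^ 2 := by
    have := norm_pos_iff.2 (add_ne_zero_iff.2 hx); positivity
  have hxu' : ‖x + u‖ ^ 2 = ‖x‖ ^ 2 + 2 * ⟪x, u⟫ + 1 := by
    rw [norm_add_sq_real, hu]; ring
  -- `|(1 - ‖x‖²)/‖x+u‖²| ≤ 1/2`
  have hb : -(1 / 2) ≤ (1 - ‖x‖ ^ 2) / ‖x + u‖ ^ 2 := by
    rw [le_div_iff₀ h0, hxu']; nlinarith
  intro h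
  have : t * ((1 - ‖x‖ ^ 2) / ‖x + u‖ ^ 2) ≥ -(1 / 2) := by nlinarith
  linarith

/-- `ψ(D_t x) = t ψ(x)`. [folklore] -/
theorem inv_dil (x : E) (t : ℝ) : inv u (dil u t x) = t • inv u x := by
  rw [dil, inv_inv]

/-- `D_1 = id`. [folklore] -/
theorem dil_one (x : E) : dil u 1 x = x := by
  rw [dil, one_smul, inv_inv]

/-- `D_t` fixes the pole `u`. [folklore] -/
theorem dil_pole (hu : ‖(u : E)‖ = 1) (t : ℝ) : dil u t u = u := by
  rw [dil, inv_self hu, smul_zero, inv_zero hu]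

/-- `D_t x ≠ -u`. [folklore] -/
theorem dil_ne {x : E} {t : ℝ} (h : t • inv u x ≠ -u) : dil u t x ≠ -u := inv_ne h

/-- **Group law** `D_s (D_t x) = D_{st} x`. [folklore] -/
theorem dil_dil (x : E) (s t : ℝ) : dil u s (dil u t x) = dil u (s * t) x := by
  rw [dil, inv_dil, smul_smul, dil]

/-- **The sign of `1 - ‖D_t x‖²`** is that of `1 - ‖x‖²` (`t > 0`): precisely
`1 - ‖D_t x‖² = t (1 - ‖x‖²) · 4/(‖x+u‖² ‖tψ(x)+u‖²)`. [folklore] -/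
theorem one_sub_norm_dil_sq (hu : ‖(u : E)‖ = 1) {x : E} (hx : x ≠ -u) {t : ℝ}
    (ht : t • inv u x ≠ -u) :
    1 - ‖dil u t x‖ ^ 2 =
      t * (1 - ‖x‖ ^ 2) * (4 / (‖x + u‖ ^ 2 * ‖t • inv u x + u‖ ^ 2)) := by
  have h1 := inner_inv hu (dil_ne ht)     -- `⟪ψ(D_t x), u⟫ = (1 - ‖D_t x‖²)/‖D_t x + u‖²`
  rw [inv_dil, inner_smul_left, inner_inv hu hx] at h1
  simp only [conj_trivial] at h1
  have h2 : ‖dil u t x + u‖ = 2 / ‖t • inv u x + u‖ := by rw [dil]; exact norm_inv_add _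
  have hA : 0 < ‖x + u‖ ^ 2 := by
    have := norm_pos_iff.2 (add_ne_zero_iff.2 hx); positivity
  have hB : 0 < ‖t • inv u x + u‖ := norm_pos_iff.2 (add_ne_zero_iff.2 ht)
  have hC : 0 < ‖dil u t x + u‖ ^ 2 := by rw [h2]; positivity
  rw [eq_div_iff hC.ne'] at h1
  rw [← h1, h2]
  field_simp
  ring

/-- `D_t` preserves the closed unit ball, the sphere and the open ball (`t ≥ 0`). [folklore] -/
theorem norm_dil_le_one_iff (hu : ‖(u : E)‖ = 1) {x : E} (hx : x ≠ -u) {t : ℝ} (ht : 0 < t)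
    (ht' : t • inv u x ≠ -u) :
    (‖dil u t x‖ ≤ 1 ↔ ‖x‖ ≤ 1) ∧ (‖dil u t x‖ < 1 ↔ ‖x‖ < 1) := by
  have h := one_sub_norm_dil_sq hu hx ht'
  have hQ : 0 < 4 / (‖x + u‖ ^ 2 * ‖t • inv u x + u‖ ^ 2) := by
    have h1 := norm_pos_iff.2 (add_ne_zero_iff.2 hx)
    have h2 := norm_pos_iff.2 (add_ne_zero_iff.2 ht')
    positivity
  have hn := norm_nonneg (dil u t x)
  have hn' := norm_nonneg x
  constructor
  · constructor
    · intro h1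
      by_contra h2; push Not at h2
      have : 1 - ‖x‖ ^ 2 < 0 := by nlinarith
      have : 1 - ‖dil u t x‖ ^ 2 < 0 := by rw [h]; nlinarith [mul_pos ht hQ]
      nlinarith
    · intro h1
      have : 0 ≤ 1 - ‖dil u t x‖ ^ 2 := by
        rw [h]; exact mul_nonneg (mul_nonneg ht.le (by nlinarith)) hQ.le
      nlinarith
  · constructor
    · intro h1
      by_contra h2; push Not at h2
      have : 1 - ‖x‖ ^ 2 ≤ 0 := by nlinarith
      have : 1 - ‖dil u t x‖ ^ 2 ≤ 0 := by
        rw [h]; exact mul_nonpos_of_nonpos_of_nonneg (mul_nonpos_of_nonneg_of_nonpos ht.le this) hQ.le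
      nlinarith
    · intro h1
      have : 0 < 1 - ‖dil u t x‖ ^ 2 := by
        rw [h]; exact mul_pos (mul_pos ht (by nlinarith)) hQ
      nlinarith

/-- **Shell preservation inside the ball**: for `‖x‖ ≤ 1`, `⟪x,u⟫ ≥ 0`, `0 < t ≤ 1`:
`0 ≤ 1 - ‖D_t x‖² ≤ 4 (1 - ‖x‖²)`. [folklore] -/
theorem one_sub_norm_dil_sq_le (hu : ‖(u : E)‖ = 1) {x : E} (hx : x ≠ -u) (hx1 : ‖x‖ ≤ 1)
    (hxu : 0 ≤ ⟪x, u⟫) {t : ℝ} (ht : 0 < t) (ht1 : t ≤ 1) :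
    0 ≤ 1 - ‖dil u t x‖ ^ 2 ∧ 1 - ‖dil u t x‖ ^ 2 ≤ 4 * (1 - ‖x‖ ^ 2) := by
  have ht' := smul_inv_ne hu hx hx1 ht.le
  have h := one_sub_norm_dil_sq hu hx ht'
  have hA : 1 ≤ ‖x + u‖ ^ 2 := by
    rw [norm_add_sq_real, hu]; nlinarith [norm_nonneg x]
  -- `‖tψ(x) + u‖² ≥ 1` since `⟪ψ x, u⟫ ≥ 0`
  have hpos : 0 ≤ ⟪inv u x, u⟫ := by
    rw [inner_inv hu hx]; exact div_nonneg (by nlinarith [norm_nonneg x]) (sq_nonneg _)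
  have hB : 1 ≤ ‖t • inv u x + u‖ ^ 2 := by
    rw [norm_add_sq_real, hu, norm_smul, inner_smul_left]
    simp only [conj_trivial, Real.norm_eq_abs]
    nlinarith [sq_nonneg (|t| * ‖inv u x‖), mul_nonneg ht.le hpos]
  have hQ0 : 0 ≤ 4 / (‖x + u‖ ^ 2 * ‖t • inv u x + u‖ ^ 2) := by positivity
  have hQ4 : 4 / (‖x + u‖ ^ 2 * ‖t • inv u x + u‖ ^ 2) ≤ 4 := by
    rw [div_le_iff₀ (by positivity)]; nlinarith
  have h01 : 0 ≤ 1 - ‖x‖ ^ 2 := by nlinarith [norm_nonneg x]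
  rw [h]
  refine ⟨mul_nonneg (mul_nonneg ht.le h01) hQ0, ?_⟩
  calc t * (1 - ‖x‖ ^ 2) * (4 / (‖x + u‖ ^ 2 * ‖t • inv u x + u‖ ^ 2))
      ≤ 1 * (1 - ‖x‖ ^ 2) * 4 := by
        apply mul_le_mul (mul_le_mul_of_nonneg_right ht1 h01) hQ4 hQ0
        exact mul_nonneg zero_le_one h01
    _ = 4 * (1 - ‖x‖ ^ 2) := by ring

/-- **Shell preservation outside the ball**: for `1 ≤ ‖x‖² ≤ 3/2`, `⟪x,u⟫ ≥ 0`, `0 < t ≤ 1`: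
`0 ≤ ‖D_t x‖² - 1 ≤ 8 (‖x‖² - 1)`. [folklore] -/
theorem norm_dil_sq_sub_one_le (hu : ‖(u : E)‖ = 1) {x : E} (hx : x ≠ -u) (hx1 : 1 ≤ ‖x‖ ^ 2)
    (hx2 : ‖x‖ ^ 2 ≤ 3 / 2) (hxu : 0 ≤ ⟪x, u⟫) {t : ℝ} (ht : 0 < t) (ht1 : t ≤ 1) :
    0 ≤ ‖dil u t x‖ ^ 2 - 1 ∧ ‖dil u t x‖ ^ 2 - 1 ≤ 8 * (‖x‖ ^ 2 - 1) := by
  have ht' := smul_inv_ne_of_shell hu hx hx2 hxu ht.le ht1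
  have h := one_sub_norm_dil_sq hu hx ht'
  have hA0 : 0 < ‖x + u‖ ^ 2 := by
    have := norm_pos_iff.2 (add_ne_zero_iff.2 hx); positivity
  have hA : 1 ≤ ‖x + u‖ ^ 2 := by
    rw [norm_add_sq_real, hu]; nlinarith [norm_nonneg x]
  have hxu' : ‖x + u‖ ^ 2 = ‖x‖ ^ 2 + 2 * ⟪x, u⟫ + 1 := by
    rw [norm_add_sq_real, hu]; ring
  -- `⟪ψ x, u⟫ ∈ [-1/4, 0]`
  have hneg : ⟪inv u x, u⟫ ≤ 0 := by
    rw [inner_inv hu hx]; exact div_nonpos_of_nonpos_of_nonneg (by linarith) (sq_nonneg _)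
  have hlb : -(1 / 4) ≤ ⟪inv u x, u⟫ := by
    rw [inner_inv hu hx, le_div_iff₀ hA0, hxu']; nlinarith
  have hB : 1 / 2 ≤ ‖t • inv u x + u‖ ^ 2 := by
    rw [norm_add_sq_real, hu, norm_smul, inner_smul_left]
    simp only [conj_trivial, Real.norm_eq_abs]
    nlinarith [sq_nonneg (|t| * ‖inv u x‖), mul_nonneg ht.le (by linarith : 0 ≤ -⟪inv u x, u⟫)]
  have hQ0 : 0 ≤ 4 / (‖x + u‖ ^ 2 * ‖t • inv u x + u‖ ^ 2) := by positivity
  have hQ8 : 4 / (‖x + u‖ ^ 2 * ‖t • inv u x + u‖ ^ 2) ≤ 8 := by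
    rw [div_le_iff₀ (by positivity)]; nlinarith
  have h01 : 0 ≤ ‖x‖ ^ 2 - 1 := by linarith
  have hneg' : ‖dil u t x‖ ^ 2 - 1 = t * (‖x‖ ^ 2 - 1) *
      (4 / (‖x + u‖ ^ 2 * ‖t • inv u x + u‖ ^ 2)) := by linarith
  rw [hneg']
  refine ⟨mul_nonneg (mul_nonneg ht.le h01) hQ0, ?_⟩
  calc t * (‖x‖ ^ 2 - 1) * (4 / (‖x + u‖ ^ 2 * ‖t • inv u x + u‖ ^ 2))
      ≤ 1 * (‖x‖ ^ 2 - 1) * 8 := by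
        apply mul_le_mul (mul_le_mul_of_nonneg_right ht1 h01) hQ8 hQ0
        exact mul_nonneg zero_le_one h01
    _ = 8 * (‖x‖ ^ 2 - 1) := by ring

/-- `D_t` is jointly smooth on `{(t, x) : x ≠ -u, t ψ(x) ≠ -u}`. [folklore] -/
theorem contDiffOn_dil (u : E) :
    ContDiffOn ℝ ∞ (fun p : ℝ × E => dil u p.1 p.2)
      {p | p.2 ≠ -u ∧ p.1 • inv u p.2 ≠ -u} := by
  have h1 : ContDiffOn ℝ ∞ (fun p : ℝ × E => inv u p.2) {p | p.2 ≠ -u ∧ p.1 • inv u p.2 ≠ -u} :=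
    (contDiffOn_inv u).comp contDiffOn_snd fun p hp => hp.1
  have h2 : ContDiffOn ℝ ∞ (fun p : ℝ × E => p.1 • inv u p.2)
      {p | p.2 ≠ -u ∧ p.1 • inv u p.2 ≠ -u} := contDiffOn_fst.smul h1
  exact (contDiffOn_inv u).comp h2 fun p hp => hp.2

/-- `D_t x` at a fixed `t` is smooth in `x` near any admissible point. [folklore] -/
theorem contDiffAt_dil {x : E} {t : ℝ} (hx : x ≠ -u) (ht : t • inv u x ≠ -u) :
    ContDiffAt ℝ ∞ (fun p : ℝ × E => dil u p.1 p.2) (t, x) := by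
  apply (contDiffOn_dil u).contDiffAt
  apply IsOpen.mem_nhds _ (show (t, x) ∈ {p : ℝ × E | p.2 ≠ -u ∧ p.1 • inv u p.2 ≠ -u} from ⟨hx, ht⟩)
  have hc1 : Continuous fun p : ℝ × E => p.2 := continuous_snd
  refine isOpen_iff_mem_nhds.2 fun p hp => ?_
  have hU : {q : ℝ × E | q.2 ≠ -u} ∈ 𝓝 p := (isOpen_ne.preimage hc1).mem_nhds hp.1
  -- continuity of `q ↦ q.1 • ψ(q.2)` near `p`
  have hc : ContinuousAt (fun q : ℝ × E => q.1 • inv u q.2) p :=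
    continuousAt_fst.smul ((contDiffAt_inv hp.1).continuousAt.comp continuousAt_snd)
  have hV : ∀ᶠ q in 𝓝 p, q.1 • inv u q.2 ≠ -u := hc.eventually_ne hp.2
  filter_upwards [hU, hV] with q hq1 hq2
  exact ⟨hq1, hq2⟩

/-! ### §3 The dilation isotopy -/

attribute [local irreducible] inv dil

/-- **Alignment data.**  `j` is a smooth embedding (with smooth inverse `jinv` on its open
image) of the open set `Oj`, which contains the region
`Ω = {x ≠ -u, ‖ψ x‖ < r', ‖x‖² < 1 + 8δ}` (a lens along the cap about `u`, two-sided); `j` is the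
identity on the two-sided shell `{‖ψ x‖ < r', 1 - 8δ < ‖x‖²}` of `Oj` and maps points of the open
unit ball to the open unit ball. [folklore] -/
structure AlignData (u : E) (j jinv : E → E) (Oj : Set E) (r r' δ : ℝ) : Prop where
  hu : ‖u‖ = 1
  hr : 0 < r
  hrr' : r < r'
  hr'1 : r' < 1
  hδ : 0 < δ
  hδ1 : δ ≤ 1 / 16
  hOj : IsOpen Oj
  hΩ : {x | x ≠ -u ∧ ‖inv u x‖ < r' ∧ ‖x‖ ^ 2 < 1 + 8 * δ} ⊆ Oj
  hj : ContDiffOn ℝ ∞ j Oj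
  hjo : IsOpen (j '' Oj)
  hjinv : ContDiffOn ℝ ∞ jinv (j '' Oj)
  hleft : ∀ x ∈ Oj, jinv (j x) = x
  hid : ∀ x ∈ Oj, ‖inv u x‖ < r' → 1 - 8 * δ < ‖x‖ ^ 2 → j x = x
  hball : ∀ x ∈ Oj, ‖x‖ < 1 → ‖j x‖ < 1

namespace AlignData

variable {j jinv : E → E} {Oj : Set E} {r r' δ : ℝ}

/-- The time reparametrisation `τ(t) = δ/2 + (1 - δ/2) S(t)` (`S` the smooth transition):
`τ ∈ [δ/2, 1]`, `τ = δ/2` for `t ≤ 0`, `τ 1 = 1`. [folklore] -/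
def tau (_h : AlignData u j jinv Oj r r' δ) (t : ℝ) : ℝ := δ / 2 + (1 - δ / 2) * Real.smoothTransition t

/-- `τ > 0`. [folklore] -/
theorem tau_pos (h : AlignData u j jinv Oj r r' δ) (t : ℝ) : 0 < h.tau t := by
  have h0 := Real.smoothTransition.nonneg t
  have h1 := h.hδ; have h2 := h.hδ1
  unfold tau; nlinarith

/-- `τ ≤ 1`. [folklore] -/
theorem tau_le_one (h : AlignData u j jinv Oj r r' δ) (t : ℝ) : h.tau t ≤ 1 := by
  have h0 := Real.smoothTransition.le_one t
  have h1 := h.hδ; have h2 := h.hδ1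
  unfold tau; nlinarith

/-- `τ ≤ δ` before time `0`. [folklore] -/
theorem tau_le_delta (h : AlignData u j jinv Oj r r' δ) {t : ℝ} (ht : t ≤ 0) : h.tau t ≤ δ := by
  unfold tau; rw [Real.smoothTransition.zero_of_nonpos ht]; linarith [h.hδ]

/-- `τ 1 = 1`. [folklore] -/
theorem tau_one (h : AlignData u j jinv Oj r r' δ) : h.tau 1 = 1 := by
  unfold tau; rw [Real.smoothTransition.one_of_one_le le_rfl]; ring

/-- `τ` is smooth. [folklore] -/
theorem contDiff_tau (h : AlignData u j jinv Oj r r' δ) : ContDiff ℝ ∞ h.tau :=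
  contDiff_const.add (contDiff_const.mul Real.smoothTransition.contDiff)

/-- `τ ≠ 0`. [folklore] -/
theorem tau_ne_zero (h : AlignData u j jinv Oj r r' δ) (t : ℝ) : h.tau t ≠ 0 := (h.tau_pos t).ne'

/-- The source region `O' = {x ≠ -u, ‖ψ x‖ < r', ‖x‖² < 1 + δ}`. [folklore] -/
def src (_h : AlignData u j jinv Oj r r' δ) : Set E :=
  {x | x ≠ -u ∧ ‖inv u x‖ < r' ∧ ‖x‖ ^ 2 < 1 + δ}

/-- Points of the big region `Ω` have `⟪x, u⟫ ≥ 0`. [folklore] -/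
theorem inner_nonneg_of (h : AlignData u j jinv Oj r r' δ) {x : E} (hx : x ≠ -u) (hxr : ‖inv u x‖ < r') : 0 ≤ ⟪x, u⟫ := by
  have h1 := inner_ge_mul_norm_of_norm_inv_le h.hu hx (lt_trans h.hr h.hrr').le
    h.hr'1 hxr.le
  have hc : 0 ≤ (1 - r' ^ 2) / (1 + r' ^ 2) := by
    have := h.hr'1; have := h.hr; have := h.hrr'
    exact div_nonneg (by nlinarith) (by positivity)
  nlinarith [norm_nonneg x, mul_nonneg hc (norm_nonneg x)]

/-- `t ψ(x) ≠ -u` for `x` in the big region and `0 ≤ t ≤ 1`. [folklore] -/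
theorem smul_inv_ne' (h : AlignData u j jinv Oj r r' δ) {x : E} (hx : x ≠ -u) (hxr : ‖inv u x‖ < r') (hx2 : ‖x‖ ^ 2 < 1 + 8 * δ)
    {t : ℝ} (ht : 0 ≤ t) (ht1 : t ≤ 1) : t • inv u x ≠ -u := by
  by_cases h1 : ‖x‖ ≤ 1
  · exact smul_inv_ne h.hu hx h1 ht
  · push Not at h1
    have : ‖x‖ ^ 2 ≤ 3 / 2 := by have := h.hδ1; nlinarith
    exact smul_inv_ne_of_shell h.hu hx this (h.inner_nonneg_of hx hxr) ht ht1

/-- **The dilated point stays in the big region** (which lies in `Oj`): for `x ≠ -u` with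
`‖ψ x‖ < r'`, `‖x‖² < 1 + δ` and `0 < t ≤ 1`, the point `D_t x` has `‖ψ(D_t x)‖ < r'` and
`‖D_t x‖² < 1 + 8δ`. [folklore] -/
theorem dil_mem (h : AlignData u j jinv Oj r r' δ) {x : E} (hx : x ∈ h.src) {t : ℝ} (ht : 0 < t) (ht1 : t ≤ 1) :
    dil u t x ≠ -u ∧ ‖inv u (dil u t x)‖ < r' ∧ ‖dil u t x‖ ^ 2 < 1 + 8 * δ := by
  obtain ⟨hx0, hxr, hx2⟩ := hx
  have ht' := h.smul_inv_ne' hx0 hxr (by linarith [h.hδ]) ht.le ht1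
  refine ⟨dil_ne ht', ?_, ?_⟩
  · rw [inv_dil, norm_smul, Real.norm_eq_abs, abs_of_pos ht]
    calc t * ‖inv u x‖ ≤ 1 * ‖inv u x‖ := mul_le_mul_of_nonneg_right ht1 (norm_nonneg _)
      _ < r' := by rw [one_mul]; exact hxr
  · by_cases h1 : ‖x‖ ≤ 1
    · have := (norm_dil_le_one_iff h.hu hx0 ht ht').1.2 h1
      have hδ := h.hδ
      nlinarith [norm_nonneg (dil u t x)]
    · push Not at h1
      have hx1 : 1 ≤ ‖x‖ ^ 2 := by nlinarith
      have := (norm_dil_sq_sub_one_le h.hu hx0 hx1 (by have := h.hδ1; nlinarith)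
        (h.inner_nonneg_of hx0 hxr) ht ht1).2
      have hδ := h.hδ
      nlinarith

/-- The dilated point lies in `Oj`. [folklore] -/
theorem dil_mem_Oj (h : AlignData u j jinv Oj r r' δ) {x : E} (hx : x ∈ h.src) {t : ℝ} (ht : 0 < t) (ht1 : t ≤ 1) :
    dil u t x ∈ Oj :=
  h.hΩ (h.dil_mem hx ht ht1)

/-- **The isotopy** `J(t, x) = D_{1/τ(t)} (j (D_{τ(t)} x))`. [folklore] -/
def J (h : AlignData u j jinv Oj r r' δ) (t : ℝ) (x : E) : E :=
  dil u (h.tau t)⁻¹ (j (dil u (h.tau t) x))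

/-- **The inverse isotopy** `J⁻¹(t, z) = D_{1/τ(t)} (j⁻¹ (D_{τ(t)} z))`. [folklore] -/
def Jinv (h : AlignData u j jinv Oj r r' δ) (t : ℝ) (z : E) : E :=
  dil u (h.tau t)⁻¹ (jinv (dil u (h.tau t) z))

/-- **Stationary points**: if `D_{τ(t)} x` lies in the identity shell then `J(t, x) = x`.
[folklore] -/
theorem J_eq_self_of (h : AlignData u j jinv Oj r r' δ) {x : E} (hx : x ∈ h.src) {t : ℝ}
    (hsh : 1 - 8 * δ < ‖dil u (h.tau t) x‖ ^ 2) : h.J t x = x := by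
  have ht := h.tau_pos t; have ht1 := h.tau_le_one t
  obtain ⟨hy0, hyr, hy2⟩ := h.dil_mem hx ht ht1
  have hy : j (dil u (h.tau t) x) = dil u (h.tau t) x :=
    h.hid _ (h.hΩ ⟨hy0, hyr, hy2⟩) hyr hsh
  unfold J
  rw [hy, dil_dil, inv_mul_cancel₀ (h.tau_ne_zero t), dil_one]

/-- The stationary part `W = {x ∈ O' : 1 - δ < ‖x‖²}` is fixed at all times. [folklore] -/
theorem J_eq_self_of_shell (h : AlignData u j jinv Oj r r' δ) {x : E} (hx : x ∈ h.src) (hxs : 1 - δ < ‖x‖ ^ 2) (t : ℝ) :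
    h.J t x = x := by
  apply h.J_eq_self_of hx
  have ht := h.tau_pos t; have ht1 := h.tau_le_one t
  obtain ⟨hx0, hxr, hx2⟩ := hx
  by_cases h1 : ‖x‖ ≤ 1
  · have := (one_sub_norm_dil_sq_le h.hu hx0 h1 (h.inner_nonneg_of hx0 hxr) ht ht1).2
    nlinarith
  · push Not at h1
    have ht' := h.smul_inv_ne' hx0 hxr (by linarith [h.hδ]) ht.le ht1
    have := (norm_dil_le_one_iff h.hu hx0 ht ht').1
    have : 1 < ‖dil u (h.tau t) x‖ := by
      by_contra hc; push Not at hc; exact absurd (this.1 hc) (not_le.2 h1)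
    have hδ := h.hδ
    nlinarith

/-- **Before time `0` nothing moves**: `J(t, x) = x` for `t ≤ 0`. [folklore] -/
theorem J_eq_self_of_nonpos (h : AlignData u j jinv Oj r r' δ) {x : E} (hx : x ∈ h.src) {t : ℝ} (ht0 : t ≤ 0) : h.J t x = x := by
  apply h.J_eq_self_of hx
  have ht := h.tau_pos t; have ht1 := h.tau_le_one t; have htδ := h.tau_le_delta ht0
  obtain ⟨hx0, hxr, hx2⟩ := hx
  by_cases h1 : ‖x‖ ≤ 1
  · have := (one_sub_norm_dil_sq_le h.hu hx0 h1 (h.inner_nonneg_of hx0 hxr) ht ht1)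
    -- `1 - ‖D x‖² ≤ 4 τ (1 - ‖x‖²) ≤ 4 δ`: redo with the exact formula
    have ht' := smul_inv_ne h.hu hx0 h1 ht.le
    have hf := one_sub_norm_dil_sq h.hu hx0 ht'
    have hA : 1 ≤ ‖x + u‖ ^ 2 := by
      rw [norm_add_sq_real, h.hu]; nlinarith [norm_nonneg x, h.inner_nonneg_of hx0 hxr]
    have hpos : 0 ≤ ⟪inv u x, u⟫ := by
      rw [inner_inv h.hu hx0]; exact div_nonneg (by nlinarith [norm_nonneg x]) (sq_nonneg _)
    have hB : 1 ≤ ‖h.tau t • inv u x + u‖ ^ 2 := by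
      rw [norm_add_sq_real, h.hu, norm_smul, inner_smul_left]
      simp only [conj_trivial, Real.norm_eq_abs]
      nlinarith [sq_nonneg (|h.tau t| * ‖inv u x‖), mul_nonneg ht.le hpos]
    have hQ4 : 4 / (‖x + u‖ ^ 2 * ‖h.tau t • inv u x + u‖ ^ 2) ≤ 4 := by
      rw [div_le_iff₀ (by positivity)]; nlinarith
    have hQ0 : 0 ≤ 4 / (‖x + u‖ ^ 2 * ‖h.tau t • inv u x + u‖ ^ 2) := by positivity
    have h01 : 0 ≤ 1 - ‖x‖ ^ 2 := by nlinarith [norm_nonneg x]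
    have hle : 1 - ‖dil u (h.tau t) x‖ ^ 2 ≤ 4 * δ := by
      rw [hf]
      calc h.tau t * (1 - ‖x‖ ^ 2) * (4 / (‖x + u‖ ^ 2 * ‖h.tau t • inv u x + u‖ ^ 2))
          ≤ δ * 1 * 4 := by
            apply mul_le_mul (mul_le_mul htδ (by nlinarith [norm_nonneg x]) h01 h.hδ.le) hQ4 hQ0
            exact mul_nonneg h.hδ.le zero_le_one
        _ = 4 * δ := by ring
    have hδ := h.hδ
    nlinarith
  · push Not at h1
    have ht' := h.smul_inv_ne' hx0 hxr (by linarith [h.hδ]) ht.le ht1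
    have := (norm_dil_le_one_iff h.hu hx0 ht ht').1
    have : 1 < ‖dil u (h.tau t) x‖ := by
      by_contra hc; push Not at hc; exact absurd (this.1 hc) (not_le.2 h1)
    have hδ := h.hδ
    nlinarith

/-- **At time `1` the isotopy is `j`**. [folklore] -/
theorem J_one (h : AlignData u j jinv Oj r r' δ) (x : E) : h.J 1 x = j x := by
  unfold J
  rw [h.tau_one, inv_one]
  simp only [dil_one]

/-- **Moving points stay inside the ball**: if `‖x‖² ≤ 1 - δ` then `‖J(t, x)‖ < 1`. [folklore] -/
theorem norm_J_lt_one (h : AlignData u j jinv Oj r r' δ) {x : E} (hx : x ∈ h.src) (hxs : ‖x‖ ^ 2 ≤ 1 - δ) (t : ℝ) :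
    ‖h.J t x‖ < 1 := by
  have ht := h.tau_pos t; have ht1 := h.tau_le_one t
  obtain ⟨hx0, hxr, hx2⟩ := hx
  have hx1 : ‖x‖ < 1 := by
    have := h.hδ; nlinarith [norm_nonneg x]
  have ht' := smul_inv_ne h.hu hx0 hx1.le ht.le
  have hy1 : ‖dil u (h.tau t) x‖ < 1 := (norm_dil_le_one_iff h.hu hx0 ht ht').2.2 hx1
  have hyO : dil u (h.tau t) x ∈ Oj := h.dil_mem_Oj ⟨hx0, hxr, hx2⟩ ht ht1
  have hz1 : ‖j (dil u (h.tau t) x)‖ < 1 := h.hball _ hyO hy1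
  have hz0 : j (dil u (h.tau t) x) ≠ -u := by
    intro hc; rw [hc, norm_neg, h.hu] at hz1; exact lt_irrefl _ hz1
  have hti : 0 < (h.tau t)⁻¹ := inv_pos.2 ht
  have hz' := smul_inv_ne h.hu hz0 hz1.le hti.le
  unfold J
  exact (norm_dil_le_one_iff h.hu hz0 hti hz').2.2 hz1

/-- `j ∘ jinv = id` on the image. [folklore] -/
theorem right_inv (h : AlignData u j jinv Oj r r' δ) {z : E} (hz : z ∈ j '' Oj) : j (jinv z) = z := by
  obtain ⟨a, ha, rfl⟩ := hz
  rw [h.hleft a ha]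

/-- The source region is open. [folklore] -/
theorem isOpen_src (h : AlignData u j jinv Oj r r' δ) : IsOpen h.src := by
  refine isOpen_iff_mem_nhds.2 fun x hx => ?_
  obtain ⟨hx0, hxr, hx2⟩ := hx
  have c1 : ContinuousAt (fun y : E => ‖inv u y‖) x := (contDiffAt_inv hx0).continuousAt.norm
  have c2 : Continuous fun y : E => ‖y‖ ^ 2 := by fun_prop
  filter_upwards [isOpen_ne.mem_nhds hx0, c1.eventually (gt_mem_nhds hxr),
    c2.continuousAt.eventually (gt_mem_nhds hx2)] with y h1 h2 h3
  exact ⟨h1, h2, h3⟩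

/-- Auxiliary facts at a source point: `z = j (D_τ x)` satisfies `z ≠ -u`, `τ⁻¹ ψ(z) ≠ -u`.
[folklore] -/
theorem J_aux (h : AlignData u j jinv Oj r r' δ) {x : E} (hx : x ∈ h.src) (t : ℝ) :
    h.tau t • inv u x ≠ -u ∧ j (dil u (h.tau t) x) ≠ -u ∧
      (h.tau t)⁻¹ • inv u (j (dil u (h.tau t) x)) ≠ -u := by
  have ht := h.tau_pos t; have ht1 := h.tau_le_one t
  obtain ⟨hx0, hxr, hx2⟩ := hx
  have ht' := h.smul_inv_ne' hx0 hxr (by linarith [h.hδ]) ht.le ht1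
  have hyO : dil u (h.tau t) x ∈ Oj := h.dil_mem_Oj ⟨hx0, hxr, hx2⟩ ht ht1
  refine ⟨ht', ?_⟩
  by_cases h1 : ‖x‖ < 1
  · have hy1 : ‖dil u (h.tau t) x‖ < 1 := (norm_dil_le_one_iff h.hu hx0 ht ht').2.2 h1
    have hz1 : ‖j (dil u (h.tau t) x)‖ < 1 := h.hball _ hyO hy1
    have hz0 : j (dil u (h.tau t) x) ≠ -u := by
      intro hc; rw [hc, norm_neg, h.hu] at hz1; exact lt_irrefl _ hz1
    exact ⟨hz0, smul_inv_ne h.hu hz0 hz1.le (inv_pos.2 ht).le⟩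
  · push Not at h1
    -- shell point: `j` is the identity there
    obtain ⟨hy0, hyr, hy2⟩ := h.dil_mem ⟨hx0, hxr, hx2⟩ ht ht1
    have hsh : 1 - 8 * δ < ‖dil u (h.tau t) x‖ ^ 2 := by
      have := (norm_dil_le_one_iff h.hu hx0 ht ht').1
      have h1' : 1 ≤ ‖dil u (h.tau t) x‖ := by
        by_contra hc; push Not at hc
        have := (norm_dil_le_one_iff h.hu hx0 ht ht').2.1 hc; linarith
      have := h.hδ; nlinarith
    have hid : j (dil u (h.tau t) x) = dil u (h.tau t) x := h.hid _ hyO hyr hsh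
    rw [hid, inv_dil, smul_smul, inv_mul_cancel₀ (h.tau_ne_zero t), one_smul]
    exact ⟨hy0, inv_ne hx0⟩

/-- **The isotopy is jointly smooth** on `ℝ × O'`. [folklore] -/
theorem contDiffOn_J (h : AlignData u j jinv Oj r r' δ) :
    ContDiffOn ℝ ∞ (fun p : ℝ × E => h.J p.1 p.2) {p | p.2 ∈ h.src} := by
  have hτ : ContDiff ℝ ∞ fun p : ℝ × E => h.tau p.1 := h.contDiff_tau.comp contDiff_fst
  have hτi : ContDiff ℝ ∞ fun p : ℝ × E => (h.tau p.1)⁻¹ := hτ.inv fun p => h.tau_ne_zero p.1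
  -- `p ↦ D_{τ} p.2`
  have f1 : ContDiffOn ℝ ∞ (fun p : ℝ × E => (h.tau p.1, p.2)) {p | p.2 ∈ h.src} :=
    hτ.contDiffOn.prodMk contDiffOn_snd
  have m1 : MapsTo (fun p : ℝ × E => (h.tau p.1, p.2)) {p | p.2 ∈ h.src}
      {q : ℝ × E | q.2 ≠ -u ∧ q.1 • inv u q.2 ≠ -u} :=
    fun p hp => ⟨hp.1, (h.J_aux hp p.1).1⟩
  have h1 : ContDiffOn ℝ ∞ (fun p : ℝ × E => dil u (h.tau p.1) p.2) {p | p.2 ∈ h.src} :=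
    (contDiffOn_dil u).comp f1 m1
  -- `p ↦ j (D_τ p.2)`
  have m2 : MapsTo (fun p : ℝ × E => dil u (h.tau p.1) p.2) {p | p.2 ∈ h.src} Oj :=
    fun p hp => h.dil_mem_Oj hp (h.tau_pos _) (h.tau_le_one _)
  have h2 : ContDiffOn ℝ ∞ (fun p : ℝ × E => j (dil u (h.tau p.1) p.2)) {p | p.2 ∈ h.src} :=
    h.hj.comp h1 m2
  -- `p ↦ D_{1/τ} (j (D_τ p.2))`
  have f3 : ContDiffOn ℝ ∞ (fun p : ℝ × E => ((h.tau p.1)⁻¹, j (dil u (h.tau p.1) p.2)))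
      {p | p.2 ∈ h.src} := hτi.contDiffOn.prodMk h2
  have m3 : MapsTo (fun p : ℝ × E => ((h.tau p.1)⁻¹, j (dil u (h.tau p.1) p.2)))
      {p | p.2 ∈ h.src} {q : ℝ × E | q.2 ≠ -u ∧ q.1 • inv u q.2 ≠ -u} :=
    fun p hp => ⟨(h.J_aux hp p.1).2.1, (h.J_aux hp p.1).2.2⟩
  exact (contDiffOn_dil u).comp f3 m3

/-- The open **inverse domain**: the conditions under which the formula for `J⁻¹(t, z)` is a
composite of smooth maps landing in the source region. [folklore] -/
def invDom (h : AlignData u j jinv Oj r r' δ) : Set (ℝ × E) :=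
  {p | p.2 ≠ -u ∧ h.tau p.1 • inv u p.2 ≠ -u ∧ dil u (h.tau p.1) p.2 ∈ j '' Oj ∧
    jinv (dil u (h.tau p.1) p.2) ≠ -u ∧
    (h.tau p.1)⁻¹ • inv u (jinv (dil u (h.tau p.1) p.2)) ≠ -u ∧ h.Jinv p.1 p.2 ∈ h.src}

/-- The inverse domain is open. [folklore] -/
theorem isOpen_invDom (h : AlignData u j jinv Oj r r' δ) : IsOpen h.invDom := by
  refine isOpen_iff_mem_nhds.2 fun p hp => ?_
  obtain ⟨hp1, hp2, hp3, hp4, hp5, hp6⟩ := hp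
  have cτ : Continuous fun q : ℝ × E => h.tau q.1 := h.contDiff_tau.continuous.comp continuous_fst
  have c2 : ContinuousAt (fun q : ℝ × E => h.tau q.1 • inv u q.2) p :=
    cτ.continuousAt.smul ((contDiffAt_inv hp1).continuousAt.comp continuousAt_snd)
  have f3 : ContinuousAt (fun q : ℝ × E => (h.tau q.1, q.2)) p :=
    cτ.continuousAt.prodMk continuousAt_snd
  have c3 : ContinuousAt (fun q : ℝ × E => dil u (h.tau q.1) q.2) p :=
    ContinuousAt.comp (f := fun q : ℝ × E => (h.tau q.1, q.2))
      (g := fun q : ℝ × E => dil u q.1 q.2) (contDiffAt_dil hp1 hp2).continuousAt f3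
  have c4 : ContinuousAt (fun q : ℝ × E => jinv (dil u (h.tau q.1) q.2)) p :=
    ContinuousAt.comp (f := fun q : ℝ × E => dil u (h.tau q.1) q.2) (g := jinv)
      (h.hjinv.continuousOn.continuousAt (h.hjo.mem_nhds hp3)) c3
  have c5b : ContinuousAt (fun q : ℝ × E => inv u (jinv (dil u (h.tau q.1) q.2))) p :=
    ContinuousAt.comp (f := fun q : ℝ × E => jinv (dil u (h.tau q.1) q.2)) (g := inv u)
      (contDiffAt_inv hp4).continuousAt c4
  have cτi : ContinuousAt (fun q : ℝ × E => (h.tau q.1)⁻¹) p :=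
    cτ.continuousAt.inv₀ (h.tau_ne_zero _)
  have c5 : ContinuousAt (fun q : ℝ × E =>
      (h.tau q.1)⁻¹ • inv u (jinv (dil u (h.tau q.1) q.2))) p := cτi.smul c5b
  have f6 : ContinuousAt (fun q : ℝ × E => ((h.tau q.1)⁻¹, jinv (dil u (h.tau q.1) q.2))) p :=
    cτi.prodMk c4
  have c6 : ContinuousAt (fun q : ℝ × E => h.Jinv q.1 q.2) p :=
    ContinuousAt.comp (f := fun q : ℝ × E => ((h.tau q.1)⁻¹, jinv (dil u (h.tau q.1) q.2)))
      (g := fun q : ℝ × E => dil u q.1 q.2) (contDiffAt_dil hp4 hp5).continuousAt f6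
  filter_upwards [(isOpen_ne.preimage continuous_snd).mem_nhds hp1, c2.eventually_ne hp2,
    c3.preimage_mem_nhds (h.hjo.mem_nhds hp3), c4.eventually_ne hp4, c5.eventually_ne hp5,
    c6.preimage_mem_nhds (h.isOpen_src.mem_nhds hp6)] with q h1 h2 h3 h4 h5 h6
  exact ⟨h1, h2, h3, h4, h5, h6⟩

/-- **`J⁻¹` is smooth** on the inverse domain. [folklore] -/
theorem contDiffOn_Jinv (h : AlignData u j jinv Oj r r' δ) :
    ContDiffOn ℝ ∞ (fun p : ℝ × E => h.Jinv p.1 p.2) h.invDom := by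
  have hτ : ContDiff ℝ ∞ fun p : ℝ × E => h.tau p.1 := h.contDiff_tau.comp contDiff_fst
  have h1 : ContDiffOn ℝ ∞ (fun p : ℝ × E => dil u (h.tau p.1) p.2) h.invDom :=
    (contDiffOn_dil u).comp (hτ.contDiffOn.prodMk contDiffOn_snd) fun p hp => ⟨hp.1, hp.2.1⟩
  have h2 : ContDiffOn ℝ ∞ (fun p : ℝ × E => jinv (dil u (h.tau p.1) p.2)) h.invDom :=
    h.hjinv.comp h1 fun p hp => hp.2.2.1
  have hτi : ContDiff ℝ ∞ fun p : ℝ × E => (h.tau p.1)⁻¹ := hτ.inv fun p => h.tau_ne_zero p.1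
  exact (contDiffOn_dil u).comp (hτi.contDiffOn.prodMk h2) fun p hp => ⟨hp.2.2.2.1, hp.2.2.2.2.1⟩

/-- **Left inverse**: for a source point `x`, `(t, J(t,x))` lies in the inverse domain and
`J⁻¹(t, J(t, x)) = x`. [folklore] -/
theorem Jinv_J (h : AlignData u j jinv Oj r r' δ) {x : E} (hx : x ∈ h.src) (t : ℝ) :
    (t, h.J t x) ∈ h.invDom ∧ h.Jinv t (h.J t x) = x := by
  have ht := h.tau_pos t; have ht1 := h.tau_le_one t
  obtain ⟨ht', hz0, hz'⟩ := h.J_aux hx t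
  set y := dil u (h.tau t) x with hy
  set z := j y with hz
  have hyO : y ∈ Oj := h.dil_mem_Oj hx ht ht1
  have hy0 : y ≠ -u := dil_ne ht'
  -- `D_τ (J x) = z`
  have h1 : dil u (h.tau t) (h.J t x) = z := by
    show dil u (h.tau t) (dil u (h.tau t)⁻¹ z) = z
    rw [dil_dil, mul_inv_cancel₀ (h.tau_ne_zero t), dil_one]
  have h2 : jinv z = y := h.hleft y hyO
  have h3 : inv u y = h.tau t • inv u x := by rw [hy, inv_dil]
  have h4 : (h.tau t)⁻¹ • inv u y = inv u x := by
    rw [h3, smul_smul, inv_mul_cancel₀ (h.tau_ne_zero t), one_smul]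
  have hres : h.Jinv t (h.J t x) = x := by
    show dil u (h.tau t)⁻¹ (jinv (dil u (h.tau t) (h.J t x))) = x
    rw [h1, h2, hy, dil_dil, inv_mul_cancel₀ (h.tau_ne_zero t), dil_one]
  refine ⟨⟨dil_ne hz', ?_, ?_, ?_, ?_, ?_⟩, hres⟩
  · show h.tau t • inv u (dil u (h.tau t)⁻¹ z) ≠ -u
    rw [inv_dil, smul_smul, mul_inv_cancel₀ (h.tau_ne_zero t), one_smul]
    exact inv_ne hz0
  · rw [h1]; exact ⟨y, hyO, rfl⟩
  · rw [h1, h2]; exact hy0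
  · rw [h1, h2, h4]; exact inv_ne hx.1
  · rw [hres]; exact hx

/-- **Right inverse**: on the inverse domain `J(t, J⁻¹(t, z)) = z`. [folklore] -/
theorem J_Jinv (h : AlignData u j jinv Oj r r' δ) {p : ℝ × E} (hp : p ∈ h.invDom) :
    h.J p.1 (h.Jinv p.1 p.2) = p.2 := by
  obtain ⟨-, -, hp3, -, -, -⟩ := hp
  show dil u (h.tau p.1)⁻¹ (j (dil u (h.tau p.1)
    (dil u (h.tau p.1)⁻¹ (jinv (dil u (h.tau p.1) p.2))))) = p.2
  rw [dil_dil, mul_inv_cancel₀ (h.tau_ne_zero _), dil_one, h.right_inv hp3,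
    dil_dil, inv_mul_cancel₀ (h.tau_ne_zero _), dil_one]

/-- **The velocity** `V(t, x) = ∂ₜ J(t, x)`. [folklore] -/
def V (h : AlignData u j jinv Oj r r' δ) (p : ℝ × E) : E :=
  fderiv ℝ (fun q : ℝ × E => h.J q.1 q.2) p ((1 : ℝ), (0 : E))

/-- The velocity is smooth on `ℝ × O'`. [folklore] -/
theorem contDiffOn_V (h : AlignData u j jinv Oj r r' δ) : ContDiffOn ℝ ∞ h.V {p | p.2 ∈ h.src} := by
  have hU : IsOpen {p : ℝ × E | p.2 ∈ h.src} := h.isOpen_src.preimage continuous_snd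
  have hD := h.contDiffOn_J.fderiv_of_isOpen (m := ∞) hU (by simp)
  exact hD.clm_apply contDiffOn_const

/-- The time-slices of `J` are differentiable with derivative `V`. [folklore] -/
theorem hasDerivAt_J (h : AlignData u j jinv Oj r r' δ) {x : E} (hx : x ∈ h.src) (t : ℝ) :
    HasDerivAt (fun s => h.J s x) (h.V (t, x)) t := by
  have hU : IsOpen {p : ℝ × E | p.2 ∈ h.src} := h.isOpen_src.preimage continuous_snd
  have hd : DifferentiableAt ℝ (fun q : ℝ × E => h.J q.1 q.2) (t, x) :=
    (h.contDiffOn_J.contDiffAt (hU.mem_nhds hx)).differentiableAt (by simp)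
  have hl : HasDerivAt (fun s : ℝ => ((s, x) : ℝ × E)) ((1 : ℝ), (0 : E)) t :=
    (hasDerivAt_id t).prodMk (hasDerivAt_const t x)
  exact hd.hasFDerivAt.comp_hasDerivAt t hl

/-- Stationary points have zero velocity. [folklore] -/
theorem V_eq_zero_of_shell (h : AlignData u j jinv Oj r r' δ) {x : E} (hx : x ∈ h.src)
    (hxs : 1 - δ < ‖x‖ ^ 2) (t : ℝ) : h.V (t, x) = 0 := by
  have h1 := h.hasDerivAt_J hx t
  have h2 : HasDerivAt (fun s => h.J s x) 0 t := by
    have : (fun s => h.J s x) = fun _ => x := funext fun s => h.J_eq_self_of_shell hx hxs s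
    rw [this]; exact hasDerivAt_const t x
  exact h1.unique h2

/-! ### §4 The cut-off velocity field -/

/-- The time cutoff `β`: `1` on `[-1/2, 3/2]`, `0` off `(-1, 2)`. [folklore] -/
def beta (t : ℝ) : ℝ := Real.smoothTransition (2 * (t + 1)) * Real.smoothTransition (2 * (2 - t))

/-- `β` is smooth. [folklore] -/
theorem contDiff_beta : ContDiff ℝ ∞ beta :=
  (Real.smoothTransition.contDiff.comp (contDiff_const.mul (contDiff_id.add contDiff_const))).mul
    (Real.smoothTransition.contDiff.comp (contDiff_const.mul (contDiff_const.sub contDiff_id)))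

/-- `β = 1` on `[-1/2, 3/2]`. [folklore] -/
theorem beta_eq_one {t : ℝ} (h1 : -(1 / 2) ≤ t) (h2 : t ≤ 3 / 2) : beta t = 1 := by
  unfold beta
  rw [Real.smoothTransition.one_of_one_le (by linarith),
    Real.smoothTransition.one_of_one_le (by linarith), mul_one]

/-- `β = 0` off `[-1, 2]`. [folklore] -/
theorem beta_eq_zero {t : ℝ} (h : t ∉ Icc (-1 : ℝ) 2) : beta t = 0 := by
  unfold beta
  simp only [mem_Icc, not_and_or, not_le] at h
  rcases h with h | h
  · rw [Real.smoothTransition.zero_of_nonpos (by linarith), zero_mul]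
  · rw [Real.smoothTransition.zero_of_nonpos (x := 2 * (2 - t)) (by linarith), mul_zero]

/-- The space cutoff `ρ`: `1` on the target lens `{‖ψ x‖ ≤ r} ∩ 𝔻̄`, supported in the source
region, identically `0` near the pole. [folklore] -/
def rho (_h : AlignData u j jinv Oj r r' δ) (x : E) : ℝ :=
  Real.smoothTransition ((((r + r') / 2) ^ 2 - ‖inv u x‖ ^ 2) / (((r + r') / 2) ^ 2 - r ^ 2)) *
    Real.smoothTransition (2 * ⟪x, u⟫ + 1) *
    Real.smoothTransition ((1 + δ / 2 - ‖x‖ ^ 2) / (δ / 4))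

/-- `ρ ≥ 0`. [folklore] -/
theorem rho_nonneg (h : AlignData u j jinv Oj r r' δ) (x : E) : 0 ≤ h.rho x := by
  unfold rho
  exact mul_nonneg (mul_nonneg (Real.smoothTransition.nonneg _) (Real.smoothTransition.nonneg _))
    (Real.smoothTransition.nonneg _)

/-- `ρ ≤ 1`. [folklore] -/
theorem rho_le_one (h : AlignData u j jinv Oj r r' δ) (x : E) : h.rho x ≤ 1 := by
  unfold rho
  have a := Real.smoothTransition.nonneg ((((r + r') / 2) ^ 2 - ‖inv u x‖ ^ 2) / (((r + r') / 2) ^ 2 - r ^ 2))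
  have a' := Real.smoothTransition.le_one ((((r + r') / 2) ^ 2 - ‖inv u x‖ ^ 2) / (((r + r') / 2) ^ 2 - r ^ 2))
  have b := Real.smoothTransition.nonneg (2 * ⟪x, u⟫ + 1)
  have b' := Real.smoothTransition.le_one (2 * ⟪x, u⟫ + 1)
  have d := Real.smoothTransition.nonneg ((1 + δ / 2 - ‖x‖ ^ 2) / (δ / 4))
  have d' := Real.smoothTransition.le_one ((1 + δ / 2 - ‖x‖ ^ 2) / (δ / 4))
  have hab : Real.smoothTransition ((((r + r') / 2) ^ 2 - ‖inv u x‖ ^ 2) / (((r + r') / 2) ^ 2 - r ^ 2))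
      * Real.smoothTransition (2 * ⟪x, u⟫ + 1) ≤ 1 := by nlinarith
  nlinarith [mul_nonneg a b]

/-- `ρ = 1` on the target lens. [folklore] -/
theorem rho_eq_one (h : AlignData u j jinv Oj r r' δ) {x : E} (hx : x ≠ -u) (hxr : ‖inv u x‖ ≤ r)
    (hx1 : ‖x‖ ≤ 1) : h.rho x = 1 := by
  have hr := h.hr; have hrr' := h.hrr'; have hδ := h.hδ
  have hxu : 0 ≤ ⟪x, u⟫ := h.inner_nonneg_of hx (lt_of_le_of_lt hxr hrr')
  unfold rho
  rw [Real.smoothTransition.one_of_one_le, Real.smoothTransition.one_of_one_le (by linarith),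
    Real.smoothTransition.one_of_one_le, mul_one, mul_one]
  · rw [le_div_iff₀ (by positivity)]; nlinarith [norm_nonneg x]
  · have hden : 0 < ((r + r') / 2) ^ 2 - r ^ 2 := by nlinarith
    rw [le_div_iff₀ hden]
    nlinarith [norm_nonneg (inv u x)]

/-- Points where `ρ ≠ 0`. [folklore] -/
theorem of_rho_ne_zero (h : AlignData u j jinv Oj r r' δ) {x : E} (hx : h.rho x ≠ 0) :
    ‖inv u x‖ < (r + r') / 2 ∧ -(1 / 2) < ⟪x, u⟫ ∧ ‖x‖ ^ 2 < 1 + δ / 2 := by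
  have hr := h.hr; have hrr' := h.hrr'; have hδ := h.hδ
  unfold rho at hx
  have h1 := left_ne_zero_of_mul (left_ne_zero_of_mul hx)
  have h2 := right_ne_zero_of_mul (left_ne_zero_of_mul hx)
  have h3 := right_ne_zero_of_mul hx
  refine ⟨?_, ?_, ?_⟩
  · have hp : 0 < (((r + r') / 2) ^ 2 - ‖inv u x‖ ^ 2) / (((r + r') / 2) ^ 2 - r ^ 2) := by
      by_contra hc; push Not at hc; exact h1 (Real.smoothTransition.zero_of_nonpos hc)
    have hden : 0 < ((r + r') / 2) ^ 2 - r ^ 2 := by nlinarith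
    have := (div_pos_iff_of_pos_right hden).1 hp
    nlinarith [norm_nonneg (inv u x)]
  · by_contra hc; push Not at hc
    exact h2 (Real.smoothTransition.zero_of_nonpos (by linarith))
  · have hp : 0 < (1 + δ / 2 - ‖x‖ ^ 2) / (δ / 4) := by
      by_contra hc; push Not at hc; exact h3 (Real.smoothTransition.zero_of_nonpos hc)
    have := (div_pos_iff_of_pos_right (by positivity)).1 hp
    linarith

/-- The support of `ρ` lies in the source region. [folklore] -/
theorem mem_src_of_rho_ne_zero (h : AlignData u j jinv Oj r r' δ) {x : E} (hx : h.rho x ≠ 0) :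
    x ∈ h.src := by
  obtain ⟨h1, h2, h3⟩ := h.of_rho_ne_zero hx
  have hrr' := h.hrr'; have hδ := h.hδ
  refine ⟨ne_neg_of_inner_ne h.hu (by linarith), by linarith, by linarith⟩

/-- `ρ` is smooth. [folklore] -/
theorem contDiff_rho (h : AlignData u j jinv Oj r r' δ) : ContDiff ℝ ∞ h.rho := by
  rw [contDiff_iff_contDiffAt]
  intro x
  by_cases hx : x ≠ -u
  · unfold rho
    refine ((Real.smoothTransition.contDiff.contDiffAt.comp x ?_).mul
      (Real.smoothTransition.contDiff.contDiffAt.comp x ?_)).mul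
      (Real.smoothTransition.contDiff.contDiffAt.comp x ?_)
    · exact (contDiffAt_const.sub ((contDiffAt_inv hx).norm_sq ℝ)).div_const _
    · exact (contDiffAt_const.mul ((contDiffAt_id.inner ℝ contDiffAt_const))).add contDiffAt_const
    · exact (contDiffAt_const.sub (contDiffAt_id.norm_sq ℝ)).div_const _
  · push Not at hx
    -- near the pole the middle factor vanishes identically
    have hev : ∀ᶠ y in 𝓝 x, h.rho y = 0 := by
      have hc : Continuous fun y : E => 2 * ⟪y, u⟫ + 1 := by fun_prop
      have hx0 : 2 * ⟪x, u⟫ + 1 < 0 := by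
        rw [hx, inner_neg_left, real_inner_self_eq_norm_sq, h.hu]; norm_num
      filter_upwards [hc.continuousAt.eventually (gt_mem_nhds hx0)] with y hy
      unfold rho
      rw [Real.smoothTransition.zero_of_nonpos (x := 2 * ⟪y, u⟫ + 1) hy.le, mul_zero, zero_mul]
    exact contDiffAt_const.congr_of_eventuallyEq hev

/-- **The velocity field** `G(t, z) = β(t) ρ(J⁻¹(t,z)) V(t, J⁻¹(t,z))` on the inverse domain,
`0` off it. [folklore] -/
def G (h : AlignData u j jinv Oj r r' δ) (p : ℝ × E) : E :=
  h.invDom.indicator (fun q => (beta q.1 * h.rho (h.Jinv q.1 q.2)) • h.V (q.1, h.Jinv q.1 q.2)) p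

/-- The compact "track set" `Σ = {(t, J(t, y)) : t ∈ [-1, 2], y ∈ tsupport ρ}`. [folklore] -/
def track (h : AlignData u j jinv Oj r r' δ) : Set (ℝ × E) :=
  (fun q : ℝ × E => (q.1, h.J q.1 q.2)) '' (Icc (-1 : ℝ) 2 ×ˢ tsupport h.rho)

/-- The topological support of `ρ` is compact and lies in the source region. [folklore] -/
theorem tsupport_rho (h : AlignData u j jinv Oj r r' δ) [FiniteDimensional ℝ E] :
    IsCompact (tsupport h.rho) ∧ tsupport h.rho ⊆ h.src := by
  have hr := h.hr; have hrr' := h.hrr'; have hr'1 := h.hr'1; have hδ := h.hδ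
  set r₁ : ℝ := (r + r') / 2 with hr₁
  have hr₁0 : 0 < r₁ := by rw [hr₁]; linarith
  have hr₁1 : r₁ < 1 := by rw [hr₁]; linarith
  -- a closed bounded set containing the support
  set C : Set E := closedBall (((1 + r₁ ^ 2) / (1 - r₁ ^ 2)) • u) (2 * r₁ / (1 - r₁ ^ 2)) ∩
    {x | -(1 / 2) ≤ ⟪x, u⟫} ∩ {x | ‖x‖ ^ 2 ≤ 1 + δ / 2} with hC
  have hCc : IsClosed C := by
    refine (isClosed_closedBall.inter (isClosed_le continuous_const (by fun_prop))).inter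
      (isClosed_le (by fun_prop) continuous_const)
  have hsub : Function.support h.rho ⊆ C := by
    intro x hx
    obtain ⟨h1, h2, h3⟩ := h.of_rho_ne_zero hx
    have hx0 : x ≠ -u := ne_neg_of_inner_ne h.hu (by linarith)
    refine ⟨⟨?_, h2.le⟩, h3.le⟩
    rw [mem_closedBall, dist_eq_norm]
    exact (norm_inv_le_iff h.hu hx0 hr₁0 hr₁1).1 h1.le
  have hts : tsupport h.rho ⊆ C := closure_minimal hsub hCc
  have hCsrc : C ⊆ h.src := by
    rintro x ⟨⟨h1, h2⟩, h3⟩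
    have hx0 : x ≠ -u := ne_neg_of_inner_ne h.hu (by simp only [mem_setOf_eq] at h2; linarith)
    rw [mem_closedBall, dist_eq_norm] at h1
    have := (norm_inv_le_iff h.hu hx0 hr₁0 hr₁1).2 h1
    refine ⟨hx0, by linarith, ?_⟩
    simp only [mem_setOf_eq] at h3; linarith
  refine ⟨?_, hts.trans hCsrc⟩
  have hbdd : Bornology.IsBounded C :=
    (isBounded_closedBall.subset fun x hx => hx.1.1)
  exact (Metric.isCompact_of_isClosed_isBounded hCc hbdd).of_isClosed_subset isClosed_closure hts

/-- The track set is compact and lies in the inverse domain. [folklore] -/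
theorem track_compact_subset (h : AlignData u j jinv Oj r r' δ) [FiniteDimensional ℝ E] :
    IsCompact h.track ∧ h.track ⊆ h.invDom := by
  obtain ⟨hK, hKs⟩ := h.tsupport_rho
  constructor
  · refine (isCompact_Icc.prod hK).image_of_continuousOn ?_
    refine (contDiffOn_fst.prodMk h.contDiffOn_J).continuousOn.mono ?_
    rintro q ⟨-, hq⟩
    exact hKs hq
  · rintro _ ⟨q, ⟨-, hq⟩, rfl⟩
    exact (h.Jinv_J (hKs hq) q.1).1

/-- Off the track set the field vanishes. [folklore] -/
theorem G_eq_zero_of_not_mem_track (h : AlignData u j jinv Oj r r' δ) {p : ℝ × E}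
    (hp : p ∉ h.track) : h.G p = 0 := by
  unfold G
  by_cases hd : p ∈ h.invDom
  · rw [indicator_of_mem hd]
    by_cases hb : beta p.1 = 0
    · rw [hb, zero_mul, zero_smul]
    by_cases hr0 : h.rho (h.Jinv p.1 p.2) = 0
    · rw [hr0, mul_zero, zero_smul]
    exfalso
    apply hp
    have ht : p.1 ∈ Icc (-1 : ℝ) 2 := by
      by_contra hc; exact hb (beta_eq_zero hc)
    refine ⟨(p.1, h.Jinv p.1 p.2), ⟨ht, subset_tsupport _ hr0⟩, ?_⟩
    show (p.1, h.J p.1 (h.Jinv p.1 p.2)) = p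
    rw [h.J_Jinv hd]
  · rw [indicator_of_notMem hd]

/-- **The field is smooth.** [folklore] -/
theorem contDiff_G (h : AlignData u j jinv Oj r r' δ) [FiniteDimensional ℝ E] : ContDiff ℝ ∞ h.G := by
  -- smooth on the inverse domain
  have hS : ContDiffOn ℝ ∞
      (fun q : ℝ × E => (beta q.1 * h.rho (h.Jinv q.1 q.2)) • h.V (q.1, h.Jinv q.1 q.2))
      h.invDom := by
    have hJi := h.contDiffOn_Jinv
    have h1 : ContDiffOn ℝ ∞ (fun q : ℝ × E => beta q.1) h.invDom :=
      (contDiff_beta.comp contDiff_fst).contDiffOn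
    have h2 : ContDiffOn ℝ ∞ (fun q : ℝ × E => h.rho (h.Jinv q.1 q.2)) h.invDom :=
      h.contDiff_rho.comp_contDiffOn hJi
    have h3 : ContDiffOn ℝ ∞ (fun q : ℝ × E => h.V (q.1, h.Jinv q.1 q.2)) h.invDom :=
      h.contDiffOn_V.comp (contDiffOn_fst.prodMk hJi) fun q hq => hq.2.2.2.2.2
    exact (h1.mul h2).smul h3
  obtain ⟨hTc, hTs⟩ := h.track_compact_subset
  rw [contDiff_iff_contDiffAt]
  intro p
  by_cases hp : p ∈ h.invDom
  · have hev : h.G =ᶠ[𝓝 p]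
        fun q : ℝ × E => (beta q.1 * h.rho (h.Jinv q.1 q.2)) • h.V (q.1, h.Jinv q.1 q.2) := by
      filter_upwards [h.isOpen_invDom.mem_nhds hp] with q hq
      exact indicator_of_mem hq _
    exact (hS.contDiffAt (h.isOpen_invDom.mem_nhds hp)).congr_of_eventuallyEq hev
  · have hpT : p ∉ h.track := fun hc => hp (hTs hc)
    have hev : h.G =ᶠ[𝓝 p] fun _ => 0 := by
      filter_upwards [hTc.isClosed.isOpen_compl.mem_nhds hpT] with q hq
      exact h.G_eq_zero_of_not_mem_track hq
    exact contDiffAt_const.congr_of_eventuallyEq hev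

/-- **The field vanishes outside the time slab** `[-1, 2]`. [folklore] -/
theorem G_eq_zero_of_time (h : AlignData u j jinv Oj r r' δ) {p : ℝ × E} (hp : p.1 ∉ Icc (-1 : ℝ) 2) :
    h.G p = 0 := by
  unfold G
  by_cases hd : p ∈ h.invDom
  · rw [indicator_of_mem hd, beta_eq_zero hp, zero_mul, zero_smul]
  · rw [indicator_of_notMem hd]

/-- **The field vanishes on and outside the unit sphere.** [folklore] -/
theorem G_eq_zero_of_one_le_norm (h : AlignData u j jinv Oj r r' δ) {p : ℝ × E} (hp : 1 ≤ ‖p.2‖) :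
    h.G p = 0 := by
  unfold G
  by_cases hd : p ∈ h.invDom
  · rw [indicator_of_mem hd]
    have hy : h.Jinv p.1 p.2 ∈ h.src := hd.2.2.2.2.2
    by_cases hs : 1 - δ < ‖h.Jinv p.1 p.2‖ ^ 2
    · rw [h.V_eq_zero_of_shell hy hs, smul_zero]
    · push Not at hs
      have := h.norm_J_lt_one hy hs p.1
      rw [h.J_Jinv hd] at this
      linarith
  · rw [indicator_of_notMem hd]

/-- **Along the track of a source point with `ρ = 1`, or of a stationary point, the field is the
velocity.** [folklore] -/
theorem G_track (h : AlignData u j jinv Oj r r' δ) {y : E} (hy : y ∈ h.src)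
    (hρ : h.rho y = 1 ∨ 1 - δ < ‖y‖ ^ 2) {s : ℝ} (hs1 : -(1 / 2) ≤ s) (hs2 : s ≤ 3 / 2) :
    h.G (s, h.J s y) = h.V (s, y) := by
  obtain ⟨hd, hinv⟩ := h.Jinv_J hy s
  unfold G
  rw [indicator_of_mem hd]
  simp only [hinv, beta_eq_one hs1 hs2, one_mul]
  rcases hρ with h1 | h1
  · rw [h1, one_smul]
  · rw [h.V_eq_zero_of_shell hy h1, smul_zero]

/-! ### §5 The flow and the thick alignment theorem -/

/-- The field as a smooth time-dependent vector field on the manifold `E`. [folklore] -/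
theorem contMDiff_G_bundle (h : AlignData u j jinv Oj r r' δ) [FiniteDimensional ℝ E] :
    ContMDiff (𝓘(ℝ, ℝ).prod 𝓘(ℝ, E)) 𝓘(ℝ, E).tangent ∞
      fun p : ℝ × E => (⟨p.2, h.G p⟩ : TangentBundle 𝓘(ℝ, E) E) := by
  have hGm : ContMDiff (𝓘(ℝ, ℝ).prod 𝓘(ℝ, E)) 𝓘(ℝ, E) ∞ h.G :=
    h.contDiff_G.comp_contMDiff (contMDiff_fst.prodMk_space contMDiff_snd)
  intro p
  rw [ModelWithCorners.tangent, Bundle.contMDiffAt_totalSpace]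
  refine ⟨contMDiffAt_snd, ?_⟩
  simp only [trivializationAt_model_space_apply]
  exact hGm p

/-- The track of a source point is an integral curve of the suspension `(1, G)` on
`(-1/2, 3/2)`, provided `ρ = 1` there or the point is stationary. [folklore] -/
theorem isMIntegralCurveOn_track (h : AlignData u j jinv Oj r r' δ) {y : E} (hy : y ∈ h.src)
    (hρ : h.rho y = 1 ∨ 1 - δ < ‖y‖ ^ 2) :
    IsMIntegralCurveOn (I := 𝓘(ℝ, ℝ).prod 𝓘(ℝ, E)) (fun s => ((s, h.J s y) : ℝ × E))
      (fun p : ℝ × E => (((1 : ℝ), h.G p) : TangentSpace (𝓘(ℝ, ℝ).prod 𝓘(ℝ, E)) p))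
      (Ioo (-(1 / 2) : ℝ) (3 / 2)) := by
  intro s hs
  have hGv : h.G (s, h.J s y) = h.V (s, y) := h.G_track hy hρ hs.1.le hs.2.le
  have h1 : HasMFDerivAt 𝓘(ℝ, ℝ) 𝓘(ℝ, ℝ) (fun s : ℝ => s) s (ContinuousLinearMap.id ℝ ℝ) := by
    rw [hasMFDerivAt_iff_hasFDerivAt]; exact hasFDerivAt_id s
  have h2 : HasMFDerivAt 𝓘(ℝ, ℝ) 𝓘(ℝ, E) (fun s => h.J s y) s
      ((1 : ℝ →L[ℝ] ℝ).smulRight (h.V (s, y))) := by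
    rw [hasMFDerivAt_iff_hasFDerivAt]; exact (h.hasDerivAt_J hy s).hasFDerivAt
  have hL : ((1 : ℝ →L[ℝ] ℝ).smulRight
      ((fun p : ℝ × E => (((1 : ℝ), h.G p) : TangentSpace (𝓘(ℝ, ℝ).prod 𝓘(ℝ, E)) p))
        (s, h.J s y)) :
      TangentSpace 𝓘(ℝ, ℝ) s →L[ℝ] TangentSpace (𝓘(ℝ, ℝ).prod 𝓘(ℝ, E)) (s, h.J s y)) =
      (ContinuousLinearMap.id ℝ ℝ).prod ((1 : ℝ →L[ℝ] ℝ).smulRight (h.V (s, y))) := by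
    apply ContinuousLinearMap.ext
    intro a
    refine Prod.ext ?_ ?_
    · change (a • (((1 : ℝ), h.G (s, h.J s y)) : ℝ × E)).1 = a
      simp
    · change (a • (((1 : ℝ), h.G (s, h.J s y)) : ℝ × E)).2 = a • h.V (s, y)
      rw [Prod.smul_snd, hGv]
  have h12 := h1.prodMk h2
  show HasMFDerivWithinAt 𝓘(ℝ, ℝ) (𝓘(ℝ, ℝ).prod 𝓘(ℝ, E)) (fun s => ((s, h.J s y) : ℝ × E))
    (Ioo (-(1 / 2) : ℝ) (3 / 2)) s
    ((1 : ℝ →L[ℝ] ℝ).smulRight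
      ((fun p : ℝ × E => (((1 : ℝ), h.G p) : TangentSpace (𝓘(ℝ, ℝ).prod 𝓘(ℝ, E)) p))
        (s, h.J s y)))
  rw [hL]
  exact h12.hasMFDerivWithinAt

/-- **Thick alignment.**  Under the alignment data there is a diffeomorphism `χ` of `E` which is
the identity on and outside the unit sphere (hence preserves the open unit ball) and coincides
with `j` on the thick lens `{‖ψ x‖ ≤ r} ∩ 𝔻̄` along the cap about `u`; moreover `χ` fixes the
stationary shell points of the source region. [cite: Schultens2014, Lemma 3.2.3 (PDF p. 43)] -/
theorem exists_diffeomorph (h : AlignData u j jinv Oj r r' δ) [FiniteDimensional ℝ E] :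
    ∃ χ : E ≃ₘ⟮𝓘(ℝ, E), 𝓘(ℝ, E)⟯ E,
      (∀ z : E, 1 ≤ ‖z‖ → χ z = z) ∧
      (∀ x : E, x ≠ -u → ‖inv u x‖ ≤ r → ‖x‖ ≤ 1 → χ x = j x) ∧
      (∀ x ∈ h.src, 1 - δ < ‖x‖ ^ 2 → χ x = x) ∧
      χ '' ball (0 : E) 1 = ball 0 1 := by
  haveI : CompleteSpace E := FiniteDimensional.complete ℝ E
  have hGb := h.contMDiff_G_bundle
  have hsupp : ∀ p : ℝ × E, (p.1 ∉ Icc (-1 : ℝ) 2 ∨ p.2 ∉ closedBall (0 : E) 1) → h.G p = 0 := by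
    rintro p (hp | hp)
    · exact h.G_eq_zero_of_time hp
    · rw [mem_closedBall, dist_zero_right, not_le] at hp
      exact h.G_eq_zero_of_one_le_norm hp.le
  obtain ⟨Ψ, hΨ⟩ := SlabFlow.exists_ambientIsotopy_of_timeDependent_of_isCompact
    (J := 𝓘(ℝ, E)) (N := E) (a := -1) (b := 2) hGb (isCompact_closedBall 0 1) hsupp
  -- points on/outside the sphere never move
  have hfix : ∀ z : E, 1 ≤ ‖z‖ → ∀ t, Ψ.toFun t z = z := fun z hz t =>
    SlabFlow.apply_eq_self_of_forall_eq_zero hGb hΨ (fun t => h.G_eq_zero_of_one_le_norm hz) t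
  -- tracks
  have htrack : ∀ y ∈ h.src, (h.rho y = 1 ∨ 1 - δ < ‖y‖ ^ 2) → Ψ.toFun 1 y = h.J 1 y := by
    intro y hy hρ
    have h0 : (0 : ℝ) ∈ Ioo (-(1 / 2) : ℝ) (3 / 2) := by constructor <;> norm_num
    have h1 : (1 : ℝ) ∈ Ioo (-(1 / 2) : ℝ) (3 / 2) := by constructor <;> norm_num
    have := SlabFlow.apply_eq_of_track hGb hΨ h0 (h.isMIntegralCurveOn_track hy hρ) h1
    rw [h.J_eq_self_of_nonpos hy le_rfl] at this
    exact this.symm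
  refine ⟨Ψ.toDiffeomorph 1, fun z hz => hfix z hz 1, fun x hx hxr hx1 => ?_, fun x hx hxs => ?_, ?_⟩
  · -- on the lens: `χ x = J(1, x) = j x`
    have hsrc : x ∈ h.src := ⟨hx, lt_of_le_of_lt hxr h.hrr', by nlinarith [h.hδ, norm_nonneg x]⟩
    show Ψ.toFun 1 x = j x
    rw [htrack x hsrc (Or.inl (h.rho_eq_one hx hxr hx1)), h.J_one x]
  · show Ψ.toFun 1 x = x
    rw [htrack x hx (Or.inr hxs), h.J_eq_self_of_shell hx hxs 1]
  · -- the ball is preserved: its complement is fixed pointwise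
    set χ := Ψ.toDiffeomorph 1 with hχ
    have hout : ∀ z : E, z ∉ ball (0 : E) 1 → χ z = z := fun z hz => by
      rw [mem_ball_zero_iff, not_lt] at hz
      exact hfix z hz 1
    apply Subset.antisymm
    · rintro _ ⟨z, hz, rfl⟩
      by_contra hc
      have h1 : χ (χ z) = χ z := hout _ hc
      have h2 : χ z = z := χ.injective h1
      rw [h2] at hc
      exact hc hz
    · intro z hz
      refine ⟨χ.symm z, ?_, χ.apply_symm_apply z⟩
      by_contra hc
      have h1 : χ (χ.symm z) = χ.symm z := hout _ hc
      rw [χ.apply_symm_apply] at h1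
      rw [← h1] at hc
      exact hc hz

end AlignData



end Literature.Topology.FourManifolds.ThickAlignment
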